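import Summits.ResolutionOfSingularities.ResolutionOfSingularities.Theorems.PurelyInseparableDim4Rules
import Literature.AlgebraicGeometry.Resolution.CentreBlowupOrdAlongBasics
import Literature.AlgebraicGeometry.Resolution.PointBlowupKangaroo
import Literature.AlgebraicGeometry.Resolution.OrdZeroBasics
import HarnessLib

/-!
# An `m1` / `1h2` literal 3-cycle in class (4,1), `p = q = 2`: `¬ TerminatesM1 2 2`, `¬ Terminates1h2 2 2`

[OURS · negative result about OUR candidate frame (centre rules `m1`, `1h2` of
`PurelyInseparableDim4Rules`) — nothing about resolution of singularities; counted 0.]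
Census cell «res-dim4-pi» (D-0157 DOOR 2), brick PR-7 (desk WORD #18 (d)); kernel replay (second lane,
JUMPS row C-005) of idea-2's PATHOLOGY P-2-2 SPECIMEN B: the hypersurface `z² + x₁x₂²x₃³ + x₁x₂⁴x₄`
with all four coordinate hyperplanes exceptional reaches after one DROP step the RECURRING presented
state `s₁ = (F₁ = x₁x₂³x₄ + x₁x₂³x₃³, r = (1,3,0,0), exc = all)` (shade `d = 1`); then, always at
the origin of the `x₁`-chart, `s₁ ⟶ s₂ = (x₂³x₄ + x₁²x₂³x₃³, (0,3,0,0))` by the centre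
`V(z,x₁,x₃,x₄)`, `s₂ ⟶ s₃ = (x₁²x₂³x₄ + x₁³x₂³x₃³, (2,3,0,0))` by `V(z,x₁,x₂,x₄)`, `s₃ ⟶ s₁` by
`V(z,x₁,x₄)`.  Each centre is Hironaka-permissible ((1): `2 ≤ ord_{(x_S)} F`), satisfies
Hauser–Perlega's condition (2) (`Perm2`: `Σ_{i∈S} rᵢ + d ≤ ord_{(x_S)} F`) and has least cardinality
among such centres (all 16 coordinate sets checked by `decide`), so every edge is a `StepM1 2` and a
`Step1h2 2` edge (where a (1) ∧ (2) centre exists the two sub-rules coincide): `TerminatesM1 2 2` and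
`Terminates1h2 2 2` are false as typed (repair candidate (i) of WORD #16 (b) dies like (ii); the
`∃`-form `TerminatesSomeRule` stays a question).  Variables `x₁..x₄` are `Fin 4 = 0..3`.  Credit:
specimen by res-dim4-idea-2 (P-2-2 B); kernel replay by res-dim4-p-4.  Nothing here proves or
disproves resolution of singularities in dim ≥ 4 / char p.
-/

-- house layout `Summits/<Summit>/<Problem>` doubles the namespace component (as in the Target file)
set_option linter.dupNamespace false

noncomputable section
namespace Summit.ResolutionOfSingularities.ResolutionOfSingularities.Theorems.PIDim4
namespace M1ThreeCycle

open MvPolynomial Finset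
open Literature.AlgebraicGeometry.Resolution
open Literature.AlgebraicGeometry.Resolution.Hauser2010
open Literature.AlgebraicGeometry.Resolution.CentreBlowup

/-- The field `𝔽₂`. [folklore] -/
abbrev K2 : Type := ZMod 2

/-! ## two-monomial polynomials with unit coefficients over `𝔽₂` (the shape of all three states) -/
section TwoMonomials

variable {d₁ d₂ : Fin 4 →₀ ℕ}

/-- `x^{d₁} + x^{d₂}`. [folklore] -/
abbrev two (d₁ d₂ : Fin 4 →₀ ℕ) : MvPolynomial (Fin 4) K2 := monomial d₁ 1 + monomial d₂ 1

/-- coefficient of the first monomial. [folklore] -/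
theorem coeff_two_left (hne : d₁ ≠ d₂) : coeff d₁ (two d₁ d₂) = 1 := by
  rw [coeff_monomial_add_monomial, if_pos rfl, if_neg hne.symm, add_zero]
/-- coefficient of the second monomial. [folklore] -/
theorem coeff_two_right (hne : d₁ ≠ d₂) : coeff d₂ (two d₁ d₂) = 1 := by
  rw [coeff_monomial_add_monomial, if_neg hne, if_pos rfl, zero_add]
/-- no monomial of total degree `< 2` when both degrees are `≥ 2`. [folklore] -/
theorem coeff_two_of_degree_lt (h₁ : 2 ≤ d₁.degree) (h₂ : 2 ≤ d₂.degree) {d : Fin 4 →₀ ℕ}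
    (hd : d.degree < 2) : coeff d (two d₁ d₂) = 0 := by
  have hne₁ : d₁ ≠ d := fun h => by rw [h] at h₁; omega
  have hne₂ : d₂ ≠ d := fun h => by rw [h] at h₂; omega
  rw [coeff_monomial_add_monomial, if_neg hne₁, if_neg hne₂, add_zero]
/-- order at the origin = the smaller total degree. [folklore] -/
theorem ordZero_two (h : d₁.degree < d₂.degree) : ordZero (two d₁ d₂) = d₁.degree := by
  rw [ordZero_add_eq_left_of_lt, ordZero_monomial _ one_ne_zero]
  rw [ordZero_monomial _ one_ne_zero, ordZero_monomial _ one_ne_zero]; exact_mod_cast h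
/-- order along `C_S` = the smaller `S`-degree. [folklore] -/
theorem ordAlong_two (hne : d₁ ≠ d₂) {S : Finset (Fin 4)} (h : degIn S d₁ ≤ degIn S d₂) :
    ordAlong S (two d₁ d₂) = degIn S d₁ := by
  rw [ordAlong_two_monomials hne, min_eq_left]; exact_mod_cast h
/-- both monomials clean ⇒ cleaning changes nothing. [folklore] -/
theorem deletePthPowers_two (h₁ : ¬ IsPthPowerExponent 2 d₁) (h₂ : ¬ IsPthPowerExponent 2 d₂) :
    deletePthPowers 2 (two d₁ d₂) = two d₁ d₂ := by
  rw [deletePthPowers_add, deletePthPowers_monomial, deletePthPowers_monomial, if_neg h₁, if_neg h₂]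
/-- an exponent with an odd entry is not a square. [folklore] -/
theorem not_isPthPowerExponent_of_odd {d : Fin 4 →₀ ℕ} (i : Fin 4) (h : d i % 2 = 1) :
    ¬ IsPthPowerExponent 2 d := fun hd => by
  have := (isPthPowerExponent_iff 2 d).mp hd i; omega

/-- at the origin (`b = 0`) every old multiplicity is kept. [folklore] -/
theorem filter_origin (r : Fin 4 →₀ ℕ) : (r.filter fun i => (0 : Fin 4 → K2) i = 0) = r :=
  (Finsupp.filter_eq_self_iff _ _).mpr fun _ _ => rfl

/-- **The step at the origin of the `x₁`-chart** (`j = 0`, `b = 0`) on a two-monomial state with all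
four hyperplanes exceptional: the exponents move by the chart law, `r₀` becomes `ord_S F − 2`, the
other multiplicities and the exceptional set stay (the two new monomials being clean). [folklore] -/
theorem step_origin {S : Finset (Fin 4)} {r : Fin 4 →₀ ℕ} {n : ℕ} (hord : ordAlong S (two d₁ d₂) = n)
    (h₁ : ¬ IsPthPowerExponent 2 (chartExponent 2 S 0 d₁))
    (h₂ : ¬ IsPthPowerExponent 2 (chartExponent 2 S 0 d₂)) :
    CentreBlowup.step 2 S 0 0 (⟨two d₁ d₂, r, Finset.univ⟩ : State K2) =
      ⟨two (chartExponent 2 S 0 d₁) (chartExponent 2 S 0 d₂), r.update 0 (n - 2), Finset.univ⟩ := by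
  unfold CentreBlowup.step
  congr 1
  · rw [pointTransform, PointBlowup.translate_zero]
    show deletePthPowers 2 (chartTransform 2 S 0 (two d₁ d₂)) = _
    rw [chartTransform_monomial_add_monomial, deletePthPowers_two h₁ h₂]
  · unfold newMult
    show (r.filter fun i => (0 : Fin 4 → K2) i = 0).update 0 ((ordAlong S (two d₁ d₂)).toNat - 2) = _
    rw [filter_origin, hord, ENat.toNat_coe]

/-- the origin of a chart is again a `2`-fold point when the (uncleaned) transform is a two-monomial
sum of degrees `≥ 2`. [folklore] -/
theorem isEquimultiplePoint_origin {S : Finset (Fin 4)} {s : State K2} {e₁ e₂ : Fin 4 →₀ ℕ}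
    (h : chartTransform 2 S 0 s.F = two e₁ e₂) (h₁ : 2 ≤ e₁.degree) (h₂ : 2 ≤ e₂.degree) :
    IsEquimultiplePoint 2 S 0 0 s := by
  intro d _ hd
  rw [pointTransform, PointBlowup.translate_zero, h]
  exact coeff_two_of_degree_lt h₁ h₂ hd

/-- From conditions (1) and (2) at a coordinate set `S'`, each monomial `e` of `F` satisfies
`2 ≤ Σ_{S'} e` and `Σ_{S'} r + d ≤ Σ_{S'} e` (natural numbers; `d = 1` in all three states). [folklore] -/
theorem nat_bounds {S' : Finset (Fin 4)} {s : State K2} {e : Fin 4 →₀ ℕ}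
    (he : coeff e s.F ≠ 0) (hd : s.shade = 1) (h1 : IsPermissibleCentre 2 S' s.F)
    (h2 : Perm2 S' s) : 2 ≤ degIn S' e ∧ degIn S' s.r + 1 ≤ degIn S' e := by
  have hle := ordAlong_le_of_coeff_ne_zero (S := S') he
  have h1' : ((2 : ℕ) : ℕ∞) ≤ (degIn S' e : ℕ∞) := le_trans h1.2 hle
  have h2' : ((degIn S' s.r + 1 : ℕ) : ℕ∞) ≤ (degIn S' e : ℕ∞) := by
    have := le_trans h2 hle
    rw [hd] at this
    exact_mod_cast this
  exact ⟨by exact_mod_cast h1', by exact_mod_cast h2'⟩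

end TwoMonomials
/-! ## the three states and their centres -/

/-- exponent of `x₁x₂³x₄`. [folklore] -/ def e1A : Fin 4 →₀ ℕ := Finsupp.equivFunOnFinite.symm ![1, 3, 0, 1]
/-- exponent of `x₁x₂³x₃³`. [folklore] -/ def e1B : Fin 4 →₀ ℕ := Finsupp.equivFunOnFinite.symm ![1, 3, 3, 0]
/-- exponent of `x₂³x₄`. [folklore] -/ def e2A : Fin 4 →₀ ℕ := Finsupp.equivFunOnFinite.symm ![0, 3, 0, 1]
/-- exponent of `x₁²x₂³x₃³`. [folklore] -/ def e2B : Fin 4 →₀ ℕ := Finsupp.equivFunOnFinite.symm ![2, 3, 3, 0]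
/-- exponent of `x₁²x₂³x₄`. [folklore] -/ def e3A : Fin 4 →₀ ℕ := Finsupp.equivFunOnFinite.symm ![2, 3, 0, 1]
/-- exponent of `x₁³x₂³x₃³`. [folklore] -/ def e3B : Fin 4 →₀ ℕ := Finsupp.equivFunOnFinite.symm ![3, 3, 3, 0]
/-- multiplicities `(1,3,0,0)` of `s₁`. [folklore] -/ def r1 : Fin 4 →₀ ℕ := Finsupp.equivFunOnFinite.symm ![1, 3, 0, 0]
/-- multiplicities `(0,3,0,0)` of `s₂`. [folklore] -/ def r2 : Fin 4 →₀ ℕ := Finsupp.equivFunOnFinite.symm ![0, 3, 0, 0]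
/-- multiplicities `(2,3,0,0)` of `s₃`. [folklore] -/ def r3 : Fin 4 →₀ ℕ := Finsupp.equivFunOnFinite.symm ![2, 3, 0, 0]

/-- `e1A` coordinatewise. [folklore] -/ @[simp] theorem e1A_apply (i : Fin 4) : e1A i = ![1, 3, 0, 1] i := rfl
/-- `e1B` coordinatewise. [folklore] -/ @[simp] theorem e1B_apply (i : Fin 4) : e1B i = ![1, 3, 3, 0] i := rfl
/-- `e2A` coordinatewise. [folklore] -/ @[simp] theorem e2A_apply (i : Fin 4) : e2A i = ![0, 3, 0, 1] i := rfl
/-- `e2B` coordinatewise. [folklore] -/ @[simp] theorem e2B_apply (i : Fin 4) : e2B i = ![2, 3, 3, 0] i := rfl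
/-- `e3A` coordinatewise. [folklore] -/ @[simp] theorem e3A_apply (i : Fin 4) : e3A i = ![2, 3, 0, 1] i := rfl
/-- `e3B` coordinatewise. [folklore] -/ @[simp] theorem e3B_apply (i : Fin 4) : e3B i = ![3, 3, 3, 0] i := rfl
/-- `r1` coordinatewise. [folklore] -/ @[simp] theorem r1_apply (i : Fin 4) : r1 i = ![1, 3, 0, 0] i := rfl
/-- `r2` coordinatewise. [folklore] -/ @[simp] theorem r2_apply (i : Fin 4) : r2 i = ![0, 3, 0, 0] i := rfl
/-- `r3` coordinatewise. [folklore] -/ @[simp] theorem r3_apply (i : Fin 4) : r3 i = ![2, 3, 0, 0] i := rfl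

/-- exponents differing at one coordinate differ. [folklore] -/
private theorem ne_of_apply_ne' {d e : Fin 4 →₀ ℕ} (i : Fin 4) (h : d i ≠ e i) : d ≠ e :=
  fun hde => h (by rw [hde])
/-- the two exponents of `F₁` differ. [folklore] -/ theorem e1A_ne_e1B : e1A ≠ e1B := ne_of_apply_ne' 2 (by simp)
/-- the two exponents of `F₂` differ. [folklore] -/ theorem e2A_ne_e2B : e2A ≠ e2B := ne_of_apply_ne' 0 (by simp)
/-- the two exponents of `F₃` differ. [folklore] -/ theorem e3A_ne_e3B : e3A ≠ e3B := ne_of_apply_ne' 0 (by simp)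

/-- total degrees. [folklore] -/ theorem degree_e1A : e1A.degree = 5 := by rw [Finsupp.degree_eq_sum, Fin.sum_univ_four]; simp
/-- see `degree_e1A`. [folklore] -/ theorem degree_e1B : e1B.degree = 7 := by rw [Finsupp.degree_eq_sum, Fin.sum_univ_four]; simp
/-- see `degree_e1A`. [folklore] -/ theorem degree_e2A : e2A.degree = 4 := by rw [Finsupp.degree_eq_sum, Fin.sum_univ_four]; simp
/-- see `degree_e1A`. [folklore] -/ theorem degree_e2B : e2B.degree = 8 := by rw [Finsupp.degree_eq_sum, Fin.sum_univ_four]; simp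
/-- see `degree_e1A`. [folklore] -/ theorem degree_e3A : e3A.degree = 6 := by rw [Finsupp.degree_eq_sum, Fin.sum_univ_four]; simp
/-- see `degree_e1A`. [folklore] -/ theorem degree_e3B : e3B.degree = 9 := by rw [Finsupp.degree_eq_sum, Fin.sum_univ_four]; simp
/-- see `degree_e1A`. [folklore] -/ theorem degree_r1 : r1.degree = 4 := by rw [Finsupp.degree_eq_sum, Fin.sum_univ_four]; simp
/-- see `degree_e1A`. [folklore] -/ theorem degree_r2 : r2.degree = 3 := by rw [Finsupp.degree_eq_sum, Fin.sum_univ_four]; simp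
/-- see `degree_e1A`. [folklore] -/ theorem degree_r3 : r3.degree = 5 := by rw [Finsupp.degree_eq_sum, Fin.sum_univ_four]; simp

/-- `F₁ = x₁x₂³x₄ + x₁x₂³x₃³`, `F₂ = x₂³x₄ + x₁²x₂³x₃³`, `F₃ = x₁²x₂³x₄ + x₁³x₂³x₃³` over `𝔽₂`. [folklore] -/
def F1 : MvPolynomial (Fin 4) K2 := two e1A e1B
/-- see `F1`. [folklore] -/ def F2 : MvPolynomial (Fin 4) K2 := two e2A e2B
/-- see `F1`. [folklore] -/ def F3 : MvPolynomial (Fin 4) K2 := two e3A e3B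

/-- `s₁ = (F₁, (1,3,0,0), all four hyperplanes exceptional)` — the recurring state; `s₂`, `s₃`. [folklore] -/
def s1 : State K2 := ⟨F1, r1, Finset.univ⟩
/-- see `s1`. [folklore] -/ def s2 : State K2 := ⟨F2, r2, Finset.univ⟩
/-- see `s1`. [folklore] -/ def s3 : State K2 := ⟨F3, r3, Finset.univ⟩

/-- the centres `V(z,x₁,x₃,x₄)` (at `s₁`), `V(z,x₁,x₂,x₄)` (at `s₂`), `V(z,x₁,x₄)` (at `s₃`). [folklore] -/
def T1 : Finset (Fin 4) := {0, 2, 3}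
/-- see `T1`. [folklore] -/ def T2 : Finset (Fin 4) := {0, 1, 3}
/-- see `T1`. [folklore] -/ def T3 : Finset (Fin 4) := {0, 3}

/-- `Σ_{i ∈ T} dᵢ` for the three centres. [folklore] -/
theorem degIn_T1 (d : Fin 4 →₀ ℕ) : degIn T1 d = d 0 + d 2 + d 3 := degIn_triple (by decide) (by decide) (by decide) d
/-- see `degIn_T1`. [folklore] -/
theorem degIn_T2 (d : Fin 4 →₀ ℕ) : degIn T2 d = d 0 + d 1 + d 3 := degIn_triple (by decide) (by decide) (by decide) d
/-- see `degIn_T1`. [folklore] -/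
theorem degIn_T3 (d : Fin 4 →₀ ℕ) : degIn T3 d = d 0 + d 3 := degIn_pair (by decide) d

/-- `F₁, F₂, F₃ ≠ 0`. [folklore] -/ theorem F1_ne_zero : F1 ≠ 0 := monomial_add_monomial_ne_zero e1A_ne_e1B one_ne_zero one_ne_zero
/-- see `F1_ne_zero`. [folklore] -/ theorem F2_ne_zero : F2 ≠ 0 := monomial_add_monomial_ne_zero e2A_ne_e2B one_ne_zero one_ne_zero
/-- see `F1_ne_zero`. [folklore] -/ theorem F3_ne_zero : F3 ≠ 0 := monomial_add_monomial_ne_zero e3A_ne_e3B one_ne_zero one_ne_zero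

/-- The shade (residual order `d`) of each of the three states is `1`. [folklore] -/
theorem shade_s1 : s1.shade = 1 := by
  show ordZero (two e1A e1B) - (r1.degree : ℕ∞) = 1
  rw [ordZero_two (by rw [degree_e1A, degree_e1B]; norm_num), degree_e1A, degree_r1]; rfl
/-- see `shade_s1`. [folklore] -/
theorem shade_s2 : s2.shade = 1 := by
  show ordZero (two e2A e2B) - (r2.degree : ℕ∞) = 1
  rw [ordZero_two (by rw [degree_e2A, degree_e2B]; norm_num), degree_e2A, degree_r2]; rfl
/-- see `shade_s1`. [folklore] -/
theorem shade_s3 : s3.shade = 1 := by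
  show ordZero (two e3A e3B) - (r3.degree : ℕ∞) = 1
  rw [ordZero_two (by rw [degree_e3A, degree_e3B]; norm_num), degree_e3A, degree_r3]; rfl

/-- orders along the three chosen centres: `2`, `4`, `3`. [folklore] -/
theorem ordAlong_T1_F1 : ordAlong T1 F1 = (2 : ℕ) := by
  rw [F1, ordAlong_two e1A_ne_e1B (by simp [degIn_T1]), degIn_T1]; simp
/-- see `ordAlong_T1_F1`. [folklore] -/
theorem ordAlong_T2_F2 : ordAlong T2 F2 = (4 : ℕ) := by
  rw [F2, ordAlong_two e2A_ne_e2B (by simp [degIn_T2]), degIn_T2]; simp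
/-- see `ordAlong_T1_F1`. [folklore] -/
theorem ordAlong_T3_F3 : ordAlong T3 F3 = (3 : ℕ) := by
  rw [F3, ordAlong_two e3A_ne_e3B (by simp [degIn_T3]), degIn_T3]; simp

/-! ## the three centres are `m1` (and `1h2`) centres -/
/-- combinatorial core at `s₁`: a coordinate set meeting the bounds from both monomials of `F₁` has
at least three elements (all 16 subsets, by `decide`). [folklore] -/
private theorem three_le_card_s1 : ∀ S : Finset (Fin 4),
    2 ≤ ∑ i ∈ S, (![1, 3, 0, 1] : Fin 4 → ℕ) i →
    (∑ i ∈ S, (![1, 3, 0, 0] : Fin 4 → ℕ) i) + 1 ≤ ∑ i ∈ S, (![1, 3, 0, 1] : Fin 4 → ℕ) i →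
    (∑ i ∈ S, (![1, 3, 0, 0] : Fin 4 → ℕ) i) + 1 ≤ ∑ i ∈ S, (![1, 3, 3, 0] : Fin 4 → ℕ) i →
    3 ≤ S.card := by
  decide

/-- combinatorial core at `s₂`. [folklore] -/
private theorem three_le_card_s2 : ∀ S : Finset (Fin 4),
    2 ≤ ∑ i ∈ S, (![0, 3, 0, 1] : Fin 4 → ℕ) i →
    (∑ i ∈ S, (![0, 3, 0, 0] : Fin 4 → ℕ) i) + 1 ≤ ∑ i ∈ S, (![0, 3, 0, 1] : Fin 4 → ℕ) i →
    (∑ i ∈ S, (![0, 3, 0, 0] : Fin 4 → ℕ) i) + 1 ≤ ∑ i ∈ S, (![2, 3, 3, 0] : Fin 4 → ℕ) i →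
    3 ≤ S.card := by
  decide

/-- combinatorial core at `s₃`. [folklore] -/
private theorem two_le_card_s3 : ∀ S : Finset (Fin 4),
    2 ≤ ∑ i ∈ S, (![3, 3, 3, 0] : Fin 4 → ℕ) i →
    (∑ i ∈ S, (![2, 3, 0, 0] : Fin 4 → ℕ) i) + 1 ≤ ∑ i ∈ S, (![2, 3, 0, 1] : Fin 4 → ℕ) i →
    2 ≤ S.card := by
  decide

/-- `V(z,x₁,x₃,x₄)` is an `m1` centre at `s₁`. [folklore] -/
theorem isModeM1Centre_s1 : IsModeM1Centre 2 T1 s1 := by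
  refine ⟨⟨⟨0, by simp [T1]⟩, ?_⟩, ?_, fun S' h1 h2 => ?_⟩
  · show (2 : ℕ∞) ≤ ordAlong T1 F1
    rw [ordAlong_T1_F1]; rfl
  · show (degIn T1 r1 : ℕ∞) + s1.shade ≤ ordAlong T1 F1
    rw [shade_s1, ordAlong_T1_F1, degIn_T1]
    exact_mod_cast (show r1 0 + r1 2 + r1 3 + 1 ≤ 2 by simp)
  · have hA := nat_bounds (by rw [show s1.F = F1 from rfl, F1, coeff_two_left e1A_ne_e1B]; exact one_ne_zero)
      shade_s1 h1 h2
    have hB := nat_bounds (by rw [show s1.F = F1 from rfl, F1, coeff_two_right e1A_ne_e1B]; exact one_ne_zero)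
      shade_s1 h1 h2
    rw [show T1.card = 3 by decide]
    simp only [degIn, e1A_apply, e1B_apply, show s1.r = r1 from rfl, r1_apply] at hA hB
    exact three_le_card_s1 S' hA.1 hA.2 hB.2

/-- `V(z,x₁,x₂,x₄)` is an `m1` centre at `s₂`. [folklore] -/
theorem isModeM1Centre_s2 : IsModeM1Centre 2 T2 s2 := by
  refine ⟨⟨⟨0, by simp [T2]⟩, ?_⟩, ?_, fun S' h1 h2 => ?_⟩
  · show (2 : ℕ∞) ≤ ordAlong T2 F2
    rw [ordAlong_T2_F2]; exact_mod_cast (by norm_num : (2 : ℕ) ≤ 4)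
  · show (degIn T2 r2 : ℕ∞) + s2.shade ≤ ordAlong T2 F2
    rw [shade_s2, ordAlong_T2_F2, degIn_T2]
    exact_mod_cast (show r2 0 + r2 1 + r2 3 + 1 ≤ 4 by simp)
  · have hA := nat_bounds (by rw [show s2.F = F2 from rfl, F2, coeff_two_left e2A_ne_e2B]; exact one_ne_zero)
      shade_s2 h1 h2
    have hB := nat_bounds (by rw [show s2.F = F2 from rfl, F2, coeff_two_right e2A_ne_e2B]; exact one_ne_zero)
      shade_s2 h1 h2
    rw [show T2.card = 3 by decide]
    simp only [degIn, e2A_apply, e2B_apply, show s2.r = r2 from rfl, r2_apply] at hA hB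
    exact three_le_card_s2 S' hA.1 hA.2 hB.2

/-- `V(z,x₁,x₄)` is an `m1` centre at `s₃`. [folklore] -/
theorem isModeM1Centre_s3 : IsModeM1Centre 2 T3 s3 := by
  refine ⟨⟨⟨0, by simp [T3]⟩, ?_⟩, ?_, fun S' h1 h2 => ?_⟩
  · show (2 : ℕ∞) ≤ ordAlong T3 F3
    rw [ordAlong_T3_F3]; exact_mod_cast (by norm_num : (2 : ℕ) ≤ 3)
  · show (degIn T3 r3 : ℕ∞) + s3.shade ≤ ordAlong T3 F3
    rw [shade_s3, ordAlong_T3_F3, degIn_T3]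
    exact_mod_cast (show r3 0 + r3 3 + 1 ≤ 3 by simp)
  · have hA := nat_bounds (by rw [show s3.F = F3 from rfl, F3, coeff_two_left e3A_ne_e3B]; exact one_ne_zero)
      shade_s3 h1 h2
    have hB := nat_bounds (by rw [show s3.F = F3 from rfl, F3, coeff_two_right e3A_ne_e3B]; exact one_ne_zero)
      shade_s3 h1 h2
    rw [show T3.card = 2 by decide]
    simp only [degIn, e3A_apply, e3B_apply, show s3.r = r3 from rfl, r3_apply] at hA hB
    exact two_le_card_s3 S' hB.1 hA.2

/-- When some Hironaka-permissible centre satisfies condition (2), an `m1` centre is a `1h2` centre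
(the two sub-rules of `PurelyInseparableDim4Rules` coincide there). [folklore] -/
theorem isMode1h2Centre_of_isModeM1Centre {K : Type} [Field K] {q : ℕ} {S : Finset (Fin 4)}
    {s : State K} (h : IsModeM1Centre q S s) : IsMode1h2Centre q S s :=
  ⟨h.1, fun _ => h.2.1, fun S' h1 h2 => h.2.2 S' h1 (h2 ⟨S, h.1, h.2.1⟩)⟩
/-! ## the three steps (origin of the `x₁`-chart each time) -/

/-- chart exponents. [folklore] -/
theorem chartExponent_T1_e1A : chartExponent 2 T1 0 e1A = e2A := by
  rw [chartExponent_eq_iff, degIn_T1]; refine ⟨by simp, fun i hi => ?_⟩; fin_cases i <;> simp_all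
/-- see `chartExponent_T1_e1A`. [folklore] -/
theorem chartExponent_T1_e1B : chartExponent 2 T1 0 e1B = e2B := by
  rw [chartExponent_eq_iff, degIn_T1]; refine ⟨by simp, fun i hi => ?_⟩; fin_cases i <;> simp_all
/-- see `chartExponent_T1_e1A`. [folklore] -/
theorem chartExponent_T2_e2A : chartExponent 2 T2 0 e2A = e3A := by
  rw [chartExponent_eq_iff, degIn_T2]; refine ⟨by simp, fun i hi => ?_⟩; fin_cases i <;> simp_all
/-- see `chartExponent_T1_e1A`. [folklore] -/
theorem chartExponent_T2_e2B : chartExponent 2 T2 0 e2B = e3B := by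
  rw [chartExponent_eq_iff, degIn_T2]; refine ⟨by simp, fun i hi => ?_⟩; fin_cases i <;> simp_all
/-- see `chartExponent_T1_e1A`. [folklore] -/
theorem chartExponent_T3_e3A : chartExponent 2 T3 0 e3A = e1A := by
  rw [chartExponent_eq_iff, degIn_T3]; refine ⟨by simp, fun i hi => ?_⟩; fin_cases i <;> simp_all
/-- see `chartExponent_T1_e1A`. [folklore] -/
theorem chartExponent_T3_e3B : chartExponent 2 T3 0 e3B = e1B := by
  rw [chartExponent_eq_iff, degIn_T3]; refine ⟨by simp, fun i hi => ?_⟩; fin_cases i <;> simp_all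

/-- **E1**: the origin of the `x₁`-chart of `Bl_{V(z,x₁,x₃,x₄)}` maps `s₁` to `s₂`. [folklore] -/
theorem step_s1 : CentreBlowup.step 2 T1 0 0 s1 = s2 := by
  rw [s1, F1, step_origin ordAlong_T1_F1 (by rw [chartExponent_T1_e1A]; exact not_isPthPowerExponent_of_odd 1 (by simp))
    (by rw [chartExponent_T1_e1B]; exact not_isPthPowerExponent_of_odd 1 (by simp)), chartExponent_T1_e1A,
    chartExponent_T1_e1B, s2, F2, show r1.update 0 (2 - 2) = r2 by ext i; rw [Finsupp.update_apply]; fin_cases i <;> simp]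
/-- **E2**: the origin of the `x₁`-chart of `Bl_{V(z,x₁,x₂,x₄)}` maps `s₂` to `s₃`. [folklore] -/
theorem step_s2 : CentreBlowup.step 2 T2 0 0 s2 = s3 := by
  rw [s2, F2, step_origin ordAlong_T2_F2 (by rw [chartExponent_T2_e2A]; exact not_isPthPowerExponent_of_odd 1 (by simp))
    (by rw [chartExponent_T2_e2B]; exact not_isPthPowerExponent_of_odd 1 (by simp)), chartExponent_T2_e2A,
    chartExponent_T2_e2B, s3, F3, show r2.update 0 (4 - 2) = r3 by ext i; rw [Finsupp.update_apply]; fin_cases i <;> simp]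
/-- **E3**: the origin of the `x₁`-chart of `Bl_{V(z,x₁,x₄)}` maps `s₃` back to `s₁`. [folklore] -/
theorem step_s3 : CentreBlowup.step 2 T3 0 0 s3 = s1 := by
  rw [s3, F3, step_origin ordAlong_T3_F3 (by rw [chartExponent_T3_e3A]; exact not_isPthPowerExponent_of_odd 1 (by simp))
    (by rw [chartExponent_T3_e3B]; exact not_isPthPowerExponent_of_odd 1 (by simp)), chartExponent_T3_e3A,
    chartExponent_T3_e3B, s1, F1, show r3.update 0 (3 - 2) = r1 by ext i; rw [Finsupp.update_apply]; fin_cases i <;> simp]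

/-- the three chart origins are `2`-fold points. [folklore] -/
theorem isEquimultiplePoint_s1 : IsEquimultiplePoint 2 T1 0 0 s1 :=
  isEquimultiplePoint_origin (e₁ := e2A) (e₂ := e2B)
    (by rw [show s1.F = two e1A e1B from rfl, chartTransform_monomial_add_monomial, chartExponent_T1_e1A,
      chartExponent_T1_e1B]) (by rw [degree_e2A]; norm_num) (by rw [degree_e2B]; norm_num)
/-- see `isEquimultiplePoint_s1`. [folklore] -/
theorem isEquimultiplePoint_s2 : IsEquimultiplePoint 2 T2 0 0 s2 :=
  isEquimultiplePoint_origin (e₁ := e3A) (e₂ := e3B)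
    (by rw [show s2.F = two e2A e2B from rfl, chartTransform_monomial_add_monomial, chartExponent_T2_e2A,
      chartExponent_T2_e2B]) (by rw [degree_e3A]; norm_num) (by rw [degree_e3B]; norm_num)
/-- see `isEquimultiplePoint_s1`. [folklore] -/
theorem isEquimultiplePoint_s3 : IsEquimultiplePoint 2 T3 0 0 s3 :=
  isEquimultiplePoint_origin (e₁ := e1A) (e₂ := e1B)
    (by rw [show s3.F = two e3A e3B from rfl, chartTransform_monomial_add_monomial, chartExponent_T3_e3A,
      chartExponent_T3_e3B]) (by rw [degree_e1A]; norm_num) (by rw [degree_e1B]; norm_num)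

/-- the three edges. [folklore] -/
theorem edge_s1_s2 : Edge 2 T1 s1 s2 :=
  ⟨0, 0, by simp [T1], rfl, isEquimultiplePoint_s1, by rw [step_s1]; exact F2_ne_zero, step_s1.symm⟩
/-- see `edge_s1_s2`. [folklore] -/
theorem edge_s2_s3 : Edge 2 T2 s2 s3 :=
  ⟨0, 0, by simp [T2], rfl, isEquimultiplePoint_s2, by rw [step_s2]; exact F3_ne_zero, step_s2.symm⟩
/-- see `edge_s1_s2`. [folklore] -/
theorem edge_s3_s1 : Edge 2 T3 s3 s1 :=
  ⟨0, 0, by simp [T3], rfl, isEquimultiplePoint_s3, by rw [step_s3]; exact F1_ne_zero, step_s3.symm⟩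

/-- `s₁ ⟶ s₂ ⟶ s₃ ⟶ s₁` are `m1` steps. [folklore] -/
theorem stepM1_s1_s2 : StepM1 2 s1 s2 := ⟨T1, isModeM1Centre_s1, edge_s1_s2⟩
/-- see `stepM1_s1_s2`. [folklore] -/ theorem stepM1_s2_s3 : StepM1 2 s2 s3 := ⟨T2, isModeM1Centre_s2, edge_s2_s3⟩
/-- see `stepM1_s1_s2`. [folklore] -/ theorem stepM1_s3_s1 : StepM1 2 s3 s1 := ⟨T3, isModeM1Centre_s3, edge_s3_s1⟩

/-- an `m1` step is a `1h2` step. [folklore] -/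
theorem step1h2_of_stepM1 {K : Type} [Field K] [DecidableEq K] {q : ℕ} {s s' : State K}
    (h : StepM1 q s s') : Step1h2 q s s' := by
  obtain ⟨S, hS, hE⟩ := h
  exact ⟨S, isMode1h2Centre_of_isModeM1Centre hS, hE⟩

/-- The periodic chain `s₁, s₂, s₃, s₁, …`. [folklore] -/
def chain (k : ℕ) : State K2 := if k % 3 = 0 then s1 else if k % 3 = 1 then s2 else s3
/-- consecutive states of the chain are joined by an `m1` step. [folklore] -/
theorem chain_stepM1 (k : ℕ) : StepM1 2 (chain k) (chain (k + 1)) := by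
  unfold chain
  have h3 : k % 3 = 0 ∨ k % 3 = 1 ∨ k % 3 = 2 := by omega
  rcases h3 with h | h | h
  · rw [if_pos h, if_neg (by omega), if_pos (by omega)]; exact stepM1_s1_s2
  · rw [if_neg (by omega), if_pos h, if_neg (by omega), if_neg (by omega)]; exact stepM1_s2_s3
  · rw [if_neg (by omega), if_neg (by omega), if_pos (by omega)]; exact stepM1_s3_s1

end M1ThreeCycle

open M1ThreeCycle in
/-- **The sub-rule `m1` does not terminate at `p = q = 2`**: an explicit literal 3-cycle of `m1`
steps over `𝔽₂` (idea-2 P-2-2 SPECIMEN B; JUMPS row C-005).  A negative result about OUR candidate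
frame — nothing about resolution of singularities. [folklore] -/
theorem not_terminatesM1_two : ¬ TerminatesM1 2 2 := fun h =>
  h K2 ⟨chain, chain_stepM1⟩

open M1ThreeCycle in
/-- **Nor does the sub-rule `1h2`** (prefer condition-(2) centres, then largest): the same 3-cycle
consists of `1h2` steps; repair candidate (i) of the desk's WORD #16 (b) is dead as typed. [folklore] -/
theorem not_terminates1h2_two : ¬ Terminates1h2 2 2 := fun h =>
  h K2 ⟨chain, fun k => step1h2_of_stepM1 (chain_stepM1 k)⟩

open M1ThreeCycle in
/-- The cycle itself, rule-free: three `m1` edges `s₁ → s₂ → s₃ → s₁` over `𝔽₂` (so no well-founded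
quantity drops along `StepM1 2`). [folklore] -/
theorem exists_stepM1_three_cycle :
    ∃ a b c : State (ZMod 2), StepM1 2 a b ∧ StepM1 2 b c ∧ StepM1 2 c a :=
  ⟨s1, s2, s3, stepM1_s1_s2, stepM1_s2_s3, stepM1_s3_s1⟩

end Summit.ResolutionOfSingularities.ResolutionOfSingularities.Theorems.PIDim4

end
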